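import Literature.MathematicalPhysics.QuantumLattice.GrassmannGaussianAddition
import HarnessLib

/-!
# The Gaussian Grassmann integration of a block of fields

Trunk **QLatticeAQFT**; packaging of the Gaussian Grassmann integration layer built under
`HubbardFermiLiquid.bgm_two_point_limit` (`GrassmannIntegral*`, `GrassmannGaussian*`).  The files
so far state every result in terms of `berezinOn R s (e_*(e^{ψ̄Aψ}) * x)`; here this is packaged as
the linear map `gaussOn R e A` — the fermionic "measure" `∫P(dψ)(·)` of a block of fields
`ψ = e(·)` with action `ψ̄Aψ` (covariance `A⁻¹`), *un-normalised* (`gaussOn_one = ε det A · 1`) —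
and the main theorems are restated in the form in which they are used in multiscale analysis
(Benfatto–Giuliani–Mastropietro 2006, §2; Mastropietro 2008, Ch. 2):

* `gaussOn_spectator_mul`, `gaussOn_mul_spectator_of_commute` — linearity over the fields outside
  the block (Salmhofer 1999, Remark B.8);
* `gaussOn_map`, `gaussOn_one` — functions of the block's fields integrate to scalars; the
  normalisation `ε det A`;
* `gaussOn_spectator_mul_prod_pairs` — **Wick rule with spectator coefficients**
  `𝓔(a ∏ ψ̄_{iₐ}ψ_{jₐ}) = a · ε det A det[(A⁻¹)_{jₐ i_b}]` (Salmhofer Lemma B.7/Remark B.8;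
  Mastropietro (2.30)); `gaussOn_spectator_mul_word_eq_zero` — charge selection rule;
* `gaussOn_grassmannExp_sources` — the generating functional (Salmhofer Lemma B.6);
* `gaussOn_gaussOn_fieldSum` — **the addition principle as an iterated integration**,
  `𝓔^{ψ₁}_{A₁}(𝓔^{ψ₂}_{A₂}(g(ψ₁ + ψ₂))) = (ε det A₁ det A₂ (det A)⁻¹) 𝓔^{ψ₁}_A(g)`, `A⁻¹ = A₁⁻¹ + A₂⁻¹`
  (BGM (2.12); Mastropietro (2.39)), from `berezinOn_gaussian_fieldSum` by Fubini.

All statements are theorems; the only definition is `gaussOn` (an abbreviation-level `def`).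

## Sources

G. Benfatto, A. Giuliani, V. Mastropietro, Ann. Henri Poincaré 7 (2006), §2.1–2.2, (2.2)–(2.3),
(2.11)–(2.12) (arXiv pp. 5–6 of the held copy); bib key `BenfattoGiulianiMastropietro2006`.
V. Mastropietro, *Non-Perturbative Renormalization* (2008), Ch. 2, (2.20)–(2.24), (2.30), (2.39)
(PDF pp. 32–35 of the held copy); bib key `Mastropietro2008`.
M. Salmhofer, *Renormalization* (1999), App. B.3, Def. B.4, Lemma B.6, Lemma B.7, Remark B.8 (PDF
pp. 177–178 of the held copy); bib key `Salmhofer1999`.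
-/

noncomputable section

namespace Literature.MathematicalPhysics.QuantumLattice

section QLatticeAQFT

open ExteriorAlgebra GrassmannAlgebra

variable (R : Type*) [CommRing R] [Algebra ℚ R] {ι : Type*} [LinearOrder ι] [Fintype ι]
  {J : Type*} [LinearOrder J] [Fintype J]

/-- The **(un-normalised) Gaussian Grassmann integration** of the block of fermion fields placed
by `e : ι ⊕ₗ ι ↪o J` with action `ψ̄ A ψ`: `x ↦ ∫ dθ_{e(ι ⊕ₗ ι)} e^{ψ̄Aψ} x`, an `R`-linear map of the
Grassmann algebra into the spectators of the block (Mastropietro 2008, (2.20)–(2.23): the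
"fermionic measure" `P(dψ) = 𝒩⁻¹ ∏ dψ⁺dψ⁻ e^{-Σψ⁺g⁻¹ψ⁻}` and its expectation `∫P(dψ)F = 𝓔(F)`, here
without the normalisation `𝒩⁻¹ = (ε det A)⁻¹`, cf. `gaussOn_one`; BGM 2006, (2.2)). [folklore] -/
def gaussOn (e : ι ⊕ₗ ι ↪o J) (A : Matrix ι ι R) : GrassmannAlgebra R J →ₗ[R] GrassmannAlgebra R J :=
  berezinOn R (Finset.univ.map e.toEmbedding) ∘ₗ
    LinearMap.mulLeft R (ExteriorAlgebra.map (Function.ExtendByZero.linearMap R e)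
      (grassmannExp (quadratic R A)))

variable (e : ι ⊕ₗ ι ↪o J) (A : Matrix ι ι R)

/-- Unfolding `gaussOn`. [folklore] -/
theorem gaussOn_apply (x : GrassmannAlgebra R J) :
    gaussOn R e A x = berezinOn R (Finset.univ.map e.toEmbedding)
      (ExteriorAlgebra.map (Function.ExtendByZero.linearMap R e) (grassmannExp (quadratic R A)) * x) :=
  rfl

/-- **Linearity over spectators** (Salmhofer 1999, Remark B.8): `𝓔(a x) = a 𝓔(x)` for `a` in the
algebra of the fields outside the block. [folklore] -/
theorem gaussOn_spectator_mul {a : GrassmannAlgebra R J}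
    (ha : a ∈ spectatorSubalgebra R (Finset.univ.map e.toEmbedding)) (x : GrassmannAlgebra R J) :
    gaussOn R e A (a * x) = a * gaussOn R e A x := by
  rw [gaussOn_apply, gaussOn_apply, ← mul_assoc,
    (commute_map_extend_grassmannExp_quadratic R e A a).eq, mul_assoc,
    berezinOn_mul_of_mem_spectatorSubalgebra R ha]

/-- … and on the right for central spectators. [folklore] -/
theorem gaussOn_mul_spectator_of_commute {a : GrassmannAlgebra R J}
    (ha : a ∈ spectatorSubalgebra R (Finset.univ.map e.toEmbedding)) (hc : ∀ z, Commute a z)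
    (x : GrassmannAlgebra R J) : gaussOn R e A (x * a) = gaussOn R e A x * a := by
  rw [← (hc x).eq, gaussOn_spectator_mul R e A ha, (hc _).eq]

/-- **The Gaussian integration of a function of the block's fields is a scalar**: for `y` in the
fermion algebra, `𝓔(e_* y) = (∫ dψ̄dψ e^{ψ̄Aψ} y) · 1` (transport, `berezinOn_map_extendByZero`).
[folklore] -/
theorem gaussOn_map (y : GrassmannAlgebra R (ι ⊕ₗ ι)) :
    gaussOn R e A (ExteriorAlgebra.map (Function.ExtendByZero.linearMap R e) y) =
      algebraMap R _ (berezin R (ι ⊕ₗ ι) (grassmannExp (quadratic R A) * y)) := by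
  rw [gaussOn_apply, ← map_mul, berezinOn_map_extendByZero]

/-- The normalisation: `𝓔(1) = ε det A · 1`, `ε = (-1)^{n(n-1)/2}`
(`berezin_grassmannExp_quadratic`). [folklore] -/
theorem gaussOn_one :
    gaussOn R e A 1 = algebraMap R _ ((-1 : R) ^ (Fintype.card ι * (Fintype.card ι - 1) / 2) * A.det) := by
  rw [← map_one (ExteriorAlgebra.map (Function.ExtendByZero.linearMap R e)), gaussOn_map, mul_one,
    berezin_grassmannExp_quadratic_holds R A]

/-- **Wick rule with spectator coefficients** (Salmhofer 1999, Lemma B.7 with Remark B.8;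
Mastropietro 2008, (2.30)): for a spectator `a` and any `i j : Fin k → ι`,
`𝓔(a · ∏ₐ ψ̄_{iₐ}ψ_{jₐ}) = a · ε det A det[(A⁻¹)_{jₐ i_b}]` (`IsUnit (det A)`).
[cite: Salmhofer1999, App. B Lemma B.7] -/
theorem gaussOn_spectator_mul_prod_pairs (hA : IsUnit A.det) {a : GrassmannAlgebra R J}
    (ha : a ∈ spectatorSubalgebra R (Finset.univ.map e.toEmbedding)) {k : ℕ} (i j : Fin k → ι) :
    gaussOn R e A (a * ExteriorAlgebra.map (Function.ExtendByZero.linearMap R e)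
        ((List.ofFn fun b => psiBar R (i b) * psi R (j b)).prod)) =
      a * algebraMap R _ ((-1 : R) ^ (Fintype.card ι * (Fintype.card ι - 1) / 2) * A.det *
        (Matrix.of fun b b' => A⁻¹ (j b) (i b')).det) := by
  rw [gaussOn_spectator_mul R e A ha, gaussOn_map, berezin_grassmannExp_quadratic_mul_prod R A hA i j]

/-- **Charge selection rule with spectators**: `𝓔(a · w) = 0` for a spectator `a` and a word `w`
in the block's fields with `#ψ̄ ≠ #ψ` (BGM 2006, §2.1, symmetry (2)). [folklore] -/
theorem gaussOn_spectator_mul_word_eq_zero {a : GrassmannAlgebra R J}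
    (ha : a ∈ spectatorSubalgebra R (Finset.univ.map e.toEmbedding)) (w : List (ι × Bool))
    (hw : w.countP (fun l => l.2) ≠ w.countP (fun l => !l.2)) :
    gaussOn R e A (a * ExteriorAlgebra.map (Function.ExtendByZero.linearMap R e)
        (w.map fun l => if l.2 then psiBar R l.1 else psi R l.1).prod) = 0 := by
  rw [gaussOn_spectator_mul R e A ha, gaussOn_map,
    berezin_grassmannExp_quadratic_mul_word_eq_zero R A w hw, map_zero, mul_zero]

/-- **The generating functional** (Salmhofer Lemma B.6 / Montvay–Münster (4.24)) in terms of
`gaussOn`: `𝓔(e^{Σ(b̄ᵢψᵢ + ψ̄ᵢbᵢ)}) = (ε det A) • e^{-Σ(A⁻¹)ᵢⱼ b̄ᵢbⱼ}` for degree-one sources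
supported outside the block. [cite: Salmhofer1999, App. B Lemma B.6] -/
theorem gaussOn_grassmannExp_sources (hA : IsUnit A.det) (vbar v : ι → J → R)
    (hvbar : ∀ i k, vbar i (e k) = 0) (hv : ∀ i k, v i (e k) = 0) :
    gaussOn R e A (grassmannExp (∑ i, (ExteriorAlgebra.ι R (vbar i) * gen R (e (toLex (Sum.inr i))) +
        gen R (e (toLex (Sum.inl i))) * ExteriorAlgebra.ι R (v i)))) =
      ((-1 : R) ^ (Fintype.card ι * (Fintype.card ι - 1) / 2) * A.det) •
        grassmannExp (-∑ i, ∑ j, A⁻¹ i j • (ExteriorAlgebra.ι R (vbar i) * ExteriorAlgebra.ι R (v j))) :=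
  berezinOn_map_grassmannExp_quadratic_mul_grassmannExp_sources R e A hA vbar v hvbar hv

/-- **The addition principle as an iterated Gaussian integration** (BGM 2006, (2.12):
`∫P(dψ) F(ψ) = ∫P(dψ^{(≤0)})∫P(dψ^{(+1)}) F(ψ^{(≤0)} + ψ^{(+1)})`; Mastropietro 2008, (2.39)):
for blocks `ψ₁` before `ψ₂`, `A⁻¹ = A₁⁻¹ + A₂⁻¹` and `g` in the `ψ₁`-algebra,
`𝓔_{A₁}^{ψ₁}(𝓔_{A₂}^{ψ₂}(g(ψ₁ + ψ₂))) = (ε det A₁ det A₂ (det A)⁻¹) • 𝓔_A^{ψ₁}(g)`.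
[cite: BenfattoGiulianiMastropietro2006, (2.12)] -/
theorem gaussOn_gaussOn_fieldSum (e₁ e₂ : ι ⊕ₗ ι ↪o J)
    (h12 : ∀ x ∈ Finset.univ.map e₁.toEmbedding, ∀ y ∈ Finset.univ.map e₂.toEmbedding, x < y)
    (A₁ A₂ A : Matrix ι ι R) (hA₁ : IsUnit A₁.det) (hA₂ : IsUnit A₂.det) (hA : IsUnit A.det)
    (hAinv : A⁻¹ = A₁⁻¹ + A₂⁻¹) {g : GrassmannAlgebra R J}
    (hg : g ∈ spectatorSubalgebra R (Finset.univ.map e₁.toEmbedding)ᶜ) :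
    gaussOn R e₁ A₁ (gaussOn R e₂ A₂ (ExteriorAlgebra.map (1 + fieldShift R e₁ e₂) g)) =
      ((-1 : R) ^ (Fintype.card ι * (Fintype.card ι - 1) / 2) * A₁.det * A₂.det * Ring.inverse A.det) •
        gaussOn R e₁ A g := by
  have hd12 : Disjoint (Finset.univ.map e₁.toEmbedding) (Finset.univ.map e₂.toEmbedding) :=
    Finset.disjoint_left.2 fun x hx hx' => lt_irrefl x (h12 x hx x hx')
  have hE₁ : ExteriorAlgebra.map (Function.ExtendByZero.linearMap R e₁) (grassmannExp (quadratic R A₁)) ∈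
      spectatorSubalgebra R (Finset.univ.map e₂.toEmbedding) :=
    map_extendByZero_mem_spectatorSubalgebra R e₁ (fun k h => Finset.disjoint_left.1 hd12
      (Finset.mem_map.2 ⟨k, Finset.mem_univ k, rfl⟩) h) _
  rw [gaussOn_apply, gaussOn_apply, gaussOn_apply, ← berezinOn_mul_of_mem_spectatorSubalgebra R hE₁,
    berezinOn_berezinOn_of_forall_lt R h12, ← mul_assoc]
  exact berezinOn_gaussian_fieldSum R e₁ e₂ h12 A₁ A₂ A hA₁ hA₂ hA hAinv hg

end QLatticeAQFT

end Literature.MathematicalPhysics.QuantumLattice
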